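import Summits.ResolutionOfSingularities.ResolutionOfSingularities.Theorems.EquisingularLiftCampaignW45bAvoidBadPointScheme
import Summits.ResolutionOfSingularities.ResolutionOfSingularities.Theorems.EquisingularLiftCampaignW45bDeltaMultiplicity
import HarnessLib

/-!
# [OURS · L1 W4.5(b)] T-ΔMULT-SCHEME: the multiplicity of an equimultiple hypersurface does not rise at ANY point of `Bl_{V(e,w)}`

Crux chain w45b, working crux EL♮ = `Theses.EquisingularLift.EquisingularLiftNat` (stmt-ResolutionOfSingularities-20038), stub
`stub_elnat_three_isolated`; the coordinate-free form of T-ΔMULT (res-L1-w45b-lead-2 2026-08-27T06:04:05Z): `e`-chart at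
rational points `…CampaignW45bStrictTransformMultiplicity` (p504673, res-L1-w45b-stub-2), `w`-chart at all primes
`…CampaignW45bDeltaMultiplicity` (p506093/p506680, res-type-097, with its reduction ENGINE), AVOID-L1 (p501026) and the
dictionary `…CampaignW45bBlowupStalkDictionary` (p506193) / `…CampaignW45bBadPointCriterion` (p508624, pair form). OURS; NOT a
statement of any manuscript; AI-written, weaker than expert review. `--supports stmt-ResolutionOfSingularities-20038 --as helper`.

SETTING: `R` regular local, `e ∈ 𝔪 ∖ 𝔪²`, `w ∈ 𝔪²`, `w ∉ (e)`, `Z = V(e, w)`, `y ∈ (e, w)^ν ∖ 𝔪^{ν+1}` (a hypersurface `V(y)` of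
multiplicity `ν` at the closed point, equimultiple along `Z`).

* `isUnit_coeff_zero_of_eq` / **`le_of_algebraMap_divPow_eChart_mem_pow`** / `algebraMap_divPow_eChart_notMem_pow_succ` — the
  `e`-CHART AT ALL PRIMES (no hypothesis on the residue field): for every prime `𝔔 ⊇ 𝔪B` of `B = R[Z/e]`,
  `y/e^ν ∈ (𝔔B_𝔔)^n ⇒ n ≤ ν` (res-type-097's reduction engine run with the `e`-chart reduction map of p504673: `y/e^ν ↦ F̄ ≠ 0`,
  `deg F̄ ≤ ν`, its constant term being a unit);
* **`notMem_pow_succ_of_dictionary`** — RING CORE with an abstract dictionary `(σ, χ, φ)`: if `S′ ≃ R[I/a]_𝔔` compatibly and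
  `y/a^ν ∉ (𝔔)^{ν+1}` locally, then for every factorisation `σ y = g^ν · z` with `g ∈ (σ a, σ b)` one has `z ∉ 𝔪_{S′}^{ν+1}`;
* **`strictTransform_notMem_maximalIdeal_pow_succ`** — MAIN, scheme level: for a blowing up `π : X′ → X` along `J` with
  `J_s = (e, w)` and `x′` over `s`: if `π♯y = g^ν · z` in `𝒪_{X′,x′}` with `g ∈ (π♯e, π♯w) = J·𝒪_{X′,x′}`, then `z ∉ 𝔪_{x′}^{ν+1}` —
  the strict transform of `V(y)` has multiplicity `≤ ν` at EVERY point over `s` (and `0` at the bad point, T-AVOID-SCHEME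
  p509628). No residue-field hypothesis.

References: res-L1-w45b-lead-2 STATUS 2026-08-27T06:04:05Z «T-ΔMULT» (OURS); res-L1-w45b-plan-1 CRUX-PLAN v1.1 §3.4 L6 (OURS);
V. Cossart, U. Jannsen, S. Saito, LNM 2270 (2020), §2 — context only.
-/

noncomputable section

set_option linter.dupNamespace false -- mandated namespace `Summit.<Summit>.<Problem>` of this single-conjunct summit

open CategoryTheory AlgebraicGeometry TopologicalSpace IsLocalRing IsLocalization Polynomial
open Literature.AlgebraicGeometry.Resolution

namespace Summit.ResolutionOfSingularities.ResolutionOfSingularities.Cruxes.EquisingularLiftNat.Sections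

universe u

/-! ## §1 The `e`-chart at all primes -/

section EChart

variable {R : Type u} [CommRing R] [IsLocalRing R] {e w y : R} {ν : ℕ}

/-- If `y = c e^ν + w r` with `r ∈ (e, w)^{ν-1}`, `e ∈ 𝔪`, `w ∈ 𝔪²` and `y ∉ 𝔪^{ν+1}`, then `c` is a unit (the constant term of
`y/e^ν` as a polynomial in `w/e`). [folklore] -/
theorem isUnit_coeff_zero_of_eq (he : e ∈ maximalIdeal R) (hw : w ∈ maximalIdeal R ^ 2)
    (hy' : y ∉ maximalIdeal R ^ (ν + 1)) {c r : R} (hr : r ∈ Ideal.span {e, w} ^ (ν - 1))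
    (hycr : y = c * e ^ ν + w * r) : IsUnit c := by
  by_contra hc
  have hcm : c ∈ maximalIdeal R := (IsLocalRing.mem_maximalIdeal c).mpr hc
  apply hy'
  rw [hycr]
  refine Ideal.add_mem _ ?_ ?_
  · rw [pow_succ']
    exact Ideal.mul_mem_mul hcm (Ideal.pow_mem_pow he ν)
  · have hI : Ideal.span {e, w} ≤ maximalIdeal R := by
      rw [Ideal.span_le]
      rintro x (rfl | rfl)
      · exact he
      · exact Ideal.pow_le_self two_ne_zero hw
    have hr' : r ∈ maximalIdeal R ^ (ν - 1) := Ideal.pow_right_mono hI _ hr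
    rcases Nat.eq_zero_or_pos ν with hν | hν
    · subst hν
      rw [zero_add, pow_one]
      exact Ideal.mul_mem_right _ _ (Ideal.pow_le_self two_ne_zero hw)
    · have hpow : maximalIdeal R ^ (ν + 1) = maximalIdeal R ^ 2 * maximalIdeal R ^ (ν - 1) := by
        rw [← pow_add]; congr 1; omega
      rw [hpow]
      exact Ideal.mul_mem_mul hw hr'

end EChart

section EChartRegular

variable {R : Type u} [CommRing R] [IsRegularLocalRing R] {e w y : R} {ν : ℕ}

/-- **T-ΔMULT in the `e`-chart, ALL PRIMES: `y/e^ν ∈ (𝔔B_𝔔)^n ⇒ n ≤ ν`** for every prime `𝔔 ⊇ 𝔪B` of `B = R[Z/e]` — rational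
closed point, non-rational closed point, or the generic point of the exceptional line; no hypothesis on the residue field.
Reduction to `κ[X]_𝔮` (`𝔮 = ρ(𝔔)`), where `y/e^ν ↦ F̄ ≠ 0` of degree `≤ ν`. [folklore; res-L1-w45b-lead-2 T-ΔMULT (OURS)] -/
theorem le_of_algebraMap_divPow_eChart_mem_pow (he : e ∈ maximalIdeal R) (he₂ : e ∉ maximalIdeal R ^ 2)
    (hw : w ∈ maximalIdeal R ^ 2) (hwe : w ∉ Ideal.span {e}) (hy : y ∈ Ideal.span {e, w} ^ ν)
    (hy' : y ∉ maximalIdeal R ^ (ν + 1)) (𝔔 : Ideal (blowupAlgebra (Ideal.span {e, w}) e)) [𝔔.IsPrime]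
    (hm : (maximalIdeal R).map (algebraMap R (blowupAlgebra (Ideal.span {e, w}) e)) ≤ 𝔔) {n : ℕ}
    (h : algebraMap (blowupAlgebra (Ideal.span {e, w}) e) (Localization.AtPrime 𝔔)
        (blowupAlgebra.divPow (Ideal.span {e, w}) e hy) ∈ maximalIdeal (Localization.AtPrime 𝔔) ^ n) :
    n ≤ ν := by
  haveI := isDomain_of_isRegularLocalRing R
  have hprime : Prime e := IsRegularLocalRing.prime_of_not_mem_sq he he₂
  have hw₁ : w ∈ maximalIdeal R := Ideal.pow_le_self two_ne_zero hw
  have hab : ∀ x : R, e ∣ w * x → e ∣ x := dvd_of_prime_dvd_mul_of_not_dvd hprime hwe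
  obtain ⟨ρ, hρ⟩ := exists_ringHom_polynomial_residueField (Ideal.span {e, w}) rfl (mem_span_pair_right e w) he hw₁
    hprime.ne_zero hab
  have hsurj := aeval_gen_surjective e w
  obtain ⟨F, r, hFdeg, hr, hycr, hFd⟩ := exists_polynomial_aeval_eq_divPow (e := e) (w := w) ν hy
  have hu : IsUnit (F.coeff 0) := isUnit_coeff_zero_of_eq he hw hy' hr hycr
  have hF0 : F.map (residue R) ≠ 0 := by
    intro h0
    have h1 : (F.map (residue R)).coeff 0 = residue R (F.coeff 0) := coeff_map _ _
    rw [h0, coeff_zero] at h1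
    have h2 := hu.map (residue R)
    rw [← h1] at h2
    exact not_isUnit_zero h2
  haveI := isPrime_map_reduction hsurj hρ 𝔔 hm
  have h1 := algebraMap_reduction_mem_pow hsurj hρ 𝔔 hm h
  rw [← hFd, hρ] at h1
  exact (le_natDegree_of_algebraMap_mem_pow _ hF0 h1).trans ((natDegree_map_le).trans hFdeg)

/-- **T-ΔMULT in the `e`-chart — `ord_𝔔(y/e^ν) ≤ ν`** at every prime `𝔔 ⊇ 𝔪B` (all-primes form of p504673's
`algebraMap_divPow_notMem_maximalIdeal_pow_succ`). [folklore; res-L1-w45b-lead-2 T-ΔMULT (OURS)] -/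
theorem algebraMap_divPow_eChart_notMem_pow_succ (he : e ∈ maximalIdeal R) (he₂ : e ∉ maximalIdeal R ^ 2)
    (hw : w ∈ maximalIdeal R ^ 2) (hwe : w ∉ Ideal.span {e}) (hy : y ∈ Ideal.span {e, w} ^ ν)
    (hy' : y ∉ maximalIdeal R ^ (ν + 1)) (𝔔 : Ideal (blowupAlgebra (Ideal.span {e, w}) e)) [𝔔.IsPrime]
    (hm : (maximalIdeal R).map (algebraMap R (blowupAlgebra (Ideal.span {e, w}) e)) ≤ 𝔔) :
    algebraMap (blowupAlgebra (Ideal.span {e, w}) e) (Localization.AtPrime 𝔔)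
        (blowupAlgebra.divPow (Ideal.span {e, w}) e hy) ∉ maximalIdeal (Localization.AtPrime 𝔔) ^ (ν + 1) :=
  fun h => Nat.not_succ_le_self ν (le_of_algebraMap_divPow_eChart_mem_pow he he₂ hw hwe hy hy' 𝔔 hm h)

end EChartRegular

/-! ## §2 Ring core with an abstract dictionary -/

section Core

variable {R : Type u} [CommRing R] [IsDomain R] {S' : Type u} [CommRing S'] [IsLocalRing S']

/-- **Ring core of T-ΔMULT-SCHEME.** `R` a domain, `I ∋ b`, `a ≠ 0`, `y ∈ I^ν`; `S′` a local ring presented as `S′ ≃ R[I/a]_𝔔`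
(`𝔔` prime) compatibly with `σ : R → S′`, `χ : R[I/a] → S′`; suppose `y/a^ν ∉ (𝔔R[I/a]_𝔔)^{ν+1}`. Then for every factorisation
`σ y = g^ν · z` in `S′` with `g ∈ (σ a, σ b)` one has `z ∉ 𝔪_{S′}^{ν+1}` (`σ b = σ a · χ(b/a)`, so `g = σ a · r` and
`χ(y/a^ν) = r^ν z` by cancellation in the domain `S′`). [folklore] -/
theorem notMem_pow_succ_of_dictionary (I : Ideal R) {a b y : R} {ν : ℕ} (hb : b ∈ I) (hy : y ∈ I ^ ν) (ha0 : a ≠ 0)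
    (𝔔 : Ideal (blowupAlgebra I a)) [𝔔.IsPrime] (σ : R →+* S') (χ : blowupAlgebra I a →+* S')
    (φ : S' ≃+* Localization.AtPrime 𝔔) (hχ : ∀ r, χ (algebraMap R _ r) = σ r)
    (hφ : ∀ z, φ (χ z) = algebraMap _ (Localization.AtPrime 𝔔) z)
    (hnot : algebraMap _ (Localization.AtPrime 𝔔) (blowupAlgebra.divPow I a hy) ∉
      maximalIdeal (Localization.AtPrime 𝔔) ^ (ν + 1))
    {g z : S'} (hg : g ∈ Ideal.span {σ a, σ b}) (hfac : σ y = g ^ ν * z) :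
    z ∉ maximalIdeal S' ^ (ν + 1) := by
  intro hz
  haveI : IsDomain (Localization.Away a) :=
    IsLocalization.isDomain_localization (powers_le_nonZeroDivisors_of_noZeroDivisors ha0)
  haveI : IsDomain (Localization.AtPrime 𝔔) :=
    IsLocalization.isDomain_localization 𝔔.primeCompl_le_nonZeroDivisors
  haveI : IsDomain S' := MulEquiv.isDomain (Localization.AtPrime 𝔔) φ.toMulEquiv
  -- relations in `S′`
  have hbt : σ b = σ a * χ (blowupAlgebra.gen I a b hb) := by
    rw [← hχ, ← hχ, ← map_mul, blowupAlgebra.algebraMap_mul_gen]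
  have hyd : σ a ^ ν * χ (blowupAlgebra.divPow I a hy) = σ y := by
    rw [← hχ, ← hχ, ← map_pow, ← map_mul, algebraMap_pow_mul_divPow]
  -- `σ a ≠ 0`
  have haB : algebraMap R (blowupAlgebra I a) a ≠ 0 := by
    intro h
    apply ha0
    have hinjL : Function.Injective (algebraMap R (Localization.Away a)) :=
      IsLocalization.injective _ (powers_le_nonZeroDivisors_of_noZeroDivisors ha0)
    apply hinjL
    have h' := congrArg (Subtype.val : blowupAlgebra I a → Localization.Away a) h
    simpa [Subalgebra.coe_algebraMap] using h'
  have haS : σ a ≠ 0 := by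
    intro h
    apply haB
    apply IsLocalization.injective (Localization.AtPrime 𝔔) 𝔔.primeCompl_le_nonZeroDivisors
    rw [map_zero, ← hφ, hχ, h, map_zero]
  -- `g = r · σ a`
  have hle : Ideal.span {σ a, σ b} ≤ Ideal.span {σ a} := by
    rw [Ideal.span_le]
    rintro x (rfl | rfl)
    · exact Ideal.subset_span rfl
    · exact Ideal.mem_span_singleton.mpr ⟨_, hbt⟩
  obtain ⟨r, hr⟩ := Ideal.mem_span_singleton'.mp (hle hg)
  -- cancellation: `χ(y/a^ν) = r^ν z ∈ 𝔪^{ν+1}`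
  have hd : χ (blowupAlgebra.divPow I a hy) = r ^ ν * z := by
    apply mul_left_cancel₀ (pow_ne_zero ν haS)
    rw [hyd, hfac, ← hr, mul_pow]
    ring
  have hmem : χ (blowupAlgebra.divPow I a hy) ∈ maximalIdeal S' ^ (ν + 1) := by
    rw [hd]; exact Ideal.mul_mem_left _ _ hz
  -- transport along `φ`
  apply hnot
  rw [← hφ]
  have hmap : (maximalIdeal S').map φ.toRingHom ≤ maximalIdeal (Localization.AtPrime 𝔔) := by
    rw [Ideal.map_le_iff_le_comap]
    intro x hx
    rw [Ideal.mem_comap]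
    refine (IsLocalRing.mem_maximalIdeal _).mpr fun hu => (IsLocalRing.mem_maximalIdeal _).mp hx ?_
    simpa using hu.map φ.symm
  have h1 : φ (χ (blowupAlgebra.divPow I a hy)) ∈ ((maximalIdeal S').map φ.toRingHom) ^ (ν + 1) := by
    rw [← Ideal.map_pow]; exact Ideal.mem_map_of_mem φ.toRingHom hmem
  exact Ideal.pow_right_mono hmap _ h1

end Core

/-! ## §3 Scheme level -/

variable {X' X : Scheme.{u}} {π : X' ⟶ X} {J : X.IdealSheafData}

/-- **T-ΔMULT-SCHEME — the multiplicity of an equimultiple hypersurface does not rise under the blow-up of `V(e, w)`.**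
`π : X′ → X` a blowing up along `J`, `x′ ∈ X′` over `s`, `𝒪_{X,s}` regular local, `J_s = (e, w)` with `e ∈ 𝔪 ∖ 𝔪²`, `w ∈ 𝔪²`,
`w ∉ (e)`, `y ∈ (e, w)^ν ∖ 𝔪^{ν+1}`. If `π♯y = g^ν · z` in `𝒪_{X′,x′}` with `g ∈ (π♯e, π♯w)` (`= J·𝒪_{X′,x′}`; e.g. `g` a local
generator of the exceptional divisor and `z` the strict transform of the equation), then `z ∉ 𝔪_{x′}^{ν+1}`: the strict transform
has multiplicity `≤ ν` at `x′`. No residue-field hypothesis. [folklore; res-L1-w45b-lead-2 T-ΔMULT (OURS), scheme level] -/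
theorem strictTransform_notMem_maximalIdeal_pow_succ (hπ : IsBlowup π J) (x' : X')
    [IsRegularLocalRing (X.presheaf.stalk (π x'))]
    {e w y : X.presheaf.stalk (π x')} {ν : ℕ} (he : e ∈ maximalIdeal (X.presheaf.stalk (π x')))
    (he₂ : e ∉ maximalIdeal (X.presheaf.stalk (π x')) ^ 2) (hw : w ∈ maximalIdeal (X.presheaf.stalk (π x')) ^ 2)
    (hwe : w ∉ Ideal.span {e}) (hJ : Ideal.span {e, w} = stalkIdeal J (π x'))
    (hy : y ∈ Ideal.span {e, w} ^ ν) (hy' : y ∉ maximalIdeal (X.presheaf.stalk (π x')) ^ (ν + 1))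
    {g z : X'.presheaf.stalk x'} (hg : g ∈ Ideal.span {(π.stalkMap x').hom e, (π.stalkMap x').hom w})
    (hfac : (π.stalkMap x').hom y = g ^ ν * z) :
    z ∉ maximalIdeal (X'.presheaf.stalk x') ^ (ν + 1) := by
  haveI := isDomain_of_isRegularLocalRing (X.presheaf.stalk (π x'))
  have he0 : e ≠ 0 := by rintro rfl; exact he₂ (Ideal.zero_mem _)
  rcases exists_blowupAlgebra_stalk_ringEquiv_pair hπ x' e w hJ with ⟨𝔔, χ, φ, hχ, hφ, h𝔔⟩ | ⟨𝔔, χ, φ, hχ, hφ, h𝔔⟩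
  · -- the `e`-chart
    have hm : (maximalIdeal (X.presheaf.stalk (π x'))).map
        (algebraMap (X.presheaf.stalk (π x')) (blowupAlgebra (Ideal.span {e, w}) e)) ≤ 𝔔.asIdeal :=
      Ideal.map_le_iff_le_comap.mpr h𝔔.ge
    have hnot := algebraMap_divPow_eChart_notMem_pow_succ he he₂ hw hwe hy hy' 𝔔.asIdeal hm
    exact notMem_pow_succ_of_dictionary (Ideal.span {e, w}) (mem_span_pair_right e w) hy he0 𝔔.asIdeal
      (π.stalkMap x').hom χ φ hχ hφ hnot hg hfac
  · -- the `w`-chart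
    have hm : (maximalIdeal (X.presheaf.stalk (π x'))).map
        (algebraMap (X.presheaf.stalk (π x')) (blowupAlgebra (Ideal.span {e, w}) w)) ≤ 𝔔.asIdeal :=
      Ideal.map_le_iff_le_comap.mpr h𝔔.ge
    obtain ⟨hw0, hwe'⟩ := wChart_hypotheses he he₂ hwe
    have hnot : algebraMap (blowupAlgebra (Ideal.span {e, w}) w) (Localization.AtPrime 𝔔.asIdeal)
        (blowupAlgebra.divPow (Ideal.span {e, w}) w hy) ∉ maximalIdeal (Localization.AtPrime 𝔔.asIdeal) ^ (ν + 1) :=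
      algebraMap_divPow_wChart_notMem_pow_succ he hw hw0 hwe' hy hy' 𝔔.asIdeal hm
    have hg' : g ∈ Ideal.span {(π.stalkMap x').hom w, (π.stalkMap x').hom e} := by
      rw [Set.pair_comm]; exact hg
    exact notMem_pow_succ_of_dictionary (Ideal.span {e, w}) (b := e) (Ideal.subset_span (by simp)) hy hw0 𝔔.asIdeal
      (π.stalkMap x').hom χ φ hχ hφ hnot hg' hfac

end Summit.ResolutionOfSingularities.ResolutionOfSingularities.Cruxes.EquisingularLiftNat.Sections

end
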